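import Mathlib
import HarnessLib
import Summits.HubbardSuperconductivity.HubbardSuperconductivity.Theorems.KLProgrammeKLRegimeBetaSplitSlotsV6S
import Summits.HubbardSuperconductivity.HubbardSuperconductivity.Theorems.KLProgrammeKLRegimeSplitBundleV9

/-!
# Route `KLProgramme` — crux K3 gen 3, child 1 `KLRegimeBetaSplitV9 := BetaSplitP klPredsV9 klWindowC` CLOSED: `betaSplitP_klPredsV9 (W)`

Cell gate-hubbard-kl, seat hubbard-kl-k3c1-p2 (child-1 re-closure owner on gen 3, plan g10 17:05Z (4) / 17:26Z).  `klPredsV9 := { klPredsV8 with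
twoLeg := TwoLegStepV9 }` (Δ18: the angular (E3g) conjunct in the two-leg slot; typist k3c2-p3) has the split slot `BetaSplitAtS2` and the
engine slot `EngineBoundsAtV6S` of V8, which are the only slots child 1 reads: **`betaSplitP_klPredsV9`** is `betaSplitP_of_slotsV6S`
(`…KLRegimeBetaSplitSlotsV6S`) with the two identity slot maps.  One line; nothing new.
-/

noncomputable section

namespace Summit.HubbardSuperconductivity.HubbardSuperconductivity.Theorems.KLRegimeSplit

set_option linter.dupNamespace false -- summit = problem name (single-conjunct summit), D-0017

/-- **Child 1 at the V9 bundle, every covariance window** (in particular `klWindowC`: the gen-3 route item `KLRegimeBetaSplitV9`). -/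
theorem betaSplitP_klPredsV9 (W : Set ℝ) : BetaSplitP klPredsV9 W :=
  betaSplitP_of_slotsV6S (Pr := klPredsV9) (fun _ _ _ _ _ _ _ _ _ _ _ _ h => h) (fun _ _ _ _ _ _ _ _ _ _ _ _ h => h)

end Summit.HubbardSuperconductivity.HubbardSuperconductivity.Theorems.KLRegimeSplit

end
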